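import Summits.BirchSwinnertonDyer.BirchSwinnertonDyer.Theorems.SchneiderFreeAdditiveX3PoitouTateSelmerDualityHolds
import HarnessLib

/-!
# Crux K4 `RedSplitControlAtThree` (stmt-BirchSwinnertonDyer-24200), line `birth` v2 — stub PT1
# `stub_poitouTateSelmerStructureDuality` LANDED (registered signature verbatim)

Seat `bsd-line-chl-p2` g7 (cell `bsd-wall`; `--supports stmt-BirchSwinnertonDyer-24200`, helper).  The registered stub
`stub_poitouTateSelmerStructureDuality : ∀ (K : Type) [Field K] [NumberField K], poitouTate_selmerStructure_duality K` of
`Cruxes/RedSplitControlAtThree/Lines/birth.lean` is cell bsd-schneider's theorem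
`PoitouTateReduction.poitouTate_selmerStructure_duality_holds K` (door-c4 g18: Milne I 4.10 (b) ∧ Cor. 2.3 ∧ Thm. 2.6 ∧
Howard 2.1.11 for THE canonical local invariant maps, every number field).  The other stub of the line,
`stub_poitouTateShaTateDual` (PT2 at every number field), is reduced to the doors' reciprocity identity (R4) by
`PoitouTateShaTwoReadout.poitouTate_sha_tateDual_of_R4` (totally complex `K`, this seat) and door-c4 g19's real-place
version; the crux BY NAME modulo (R4) at the totally complex fields is `redSplitControlAtThree_of_R4` (file `…OfR4`).
HONEST FRAMING: BSD is not proved; this file only re-exports a landed theorem under the registered stub name.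

References: [MilneADT2006] I Thm. 4.10 (b); [Howard2004HeegnerKolyvagin] Thm. 2.1.11.
-/

noncomputable section

-- `Summit.<P>.<Sub>` repeats `BirchSwinnertonDyer` by the tree's layout convention (D-0017)
set_option linter.dupNamespace false

namespace Summit.BirchSwinnertonDyer.BirchSwinnertonDyer.Theorems.RedSplitControlAtThreeOfFacts

/-- **Stub PT1 of line `birth` (crux K4 `RedSplitControlAtThree`), registered signature verbatim**: Poitou–Tate duality for
Selmer structures over every number field — door-c4 g18's `poitouTate_selmerStructure_duality_holds`.
[cite: MilneADT2006, Ch. I, Thm. 4.10 (b)][cite: Howard2004HeegnerKolyvagin, Thm. 2.1.11] -/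
theorem stub_poitouTateSelmerStructureDuality :
    ∀ (K : Type) [Field K] [NumberField K],
      Literature.NumberTheory.GaloisCohomology.poitouTate_selmerStructure_duality K :=
  fun K _ _ =>
    Summit.BirchSwinnertonDyer.BirchSwinnertonDyer.Theorems.SchneiderFreeAdditiveX3.PoitouTateReduction.poitouTate_selmerStructure_duality_holds
      K

end Summit.BirchSwinnertonDyer.BirchSwinnertonDyer.Theorems.RedSplitControlAtThreeOfFacts

end
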